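import Summits.Ventures.CertifiedManyBodySolver.Theorems.M3x2EdgeSplitSymReplayShardsD
import HarnessLib

/-!
# SymReplay — SUPPORT-PRUNED («local») commutators for the Ward and EOM rows: `rhsPolyL` and its soundness (T16a; hub-lb-sym-eng-3)

sym-ref-1 g1's measurement (hub-lb STATUS 11:32Z): on the 625-site v0′ frame the Ward rows `comm (spinPlusPoly K.frame) X` and
the EOM rows `comm (hamPoly K.frame) B` are DENSE (2·|frame| raw terms per row, almost all cancelling to exact zeros) and
dominate the base shard (≈ 18 h interpreted).  The LEVER: only the sites OCCURRING in `X` (resp. the king-move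
neighbourhood of the sites of `B`) can fail to commute — `rhsPolyL` forms `comm (spinPlusPoly (sitesOf X)) X` and
`comm (hamPoly (localFrame B)) B` instead, and `polyOp_rhsPolyL_eq` proves the OPERATOR is unchanged in every window
`Λ″ ⊇ frame` (graded locality: the landed `spinPlus/Minus_commutator_transfer` with `F := sitesOf X`, the range transfer
`ham_commutator_transfer` with `I := sitesOf B`, `F := localFrame B ⊇ thicken I 1`).  Hence every soundness theorem stated
for `rhsPoly` (T10/T12) transfers verbatim to `rhsPolyL` (T16b).
No summit or crux statement is proved here; no certificate beyond toys is replayed; nothing here predicts superconductivity.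
-/

noncomputable section

namespace Summit.Ventures.CertifiedManyBodySolver.Theorems.SymReplay

open Matrix Finset
open Literature.MathematicalPhysics.QuantumLattice
open Literature.MathematicalPhysics.QuantumLattice.HubbardWave0
open Literature.MathematicalPhysics.QuantumLattice.ThermodynamicLimit
open Literature.Probability.LatticeModels
open Literature.MathematicalPhysics.QuantumManyBody.StateRelaxation
open Summit.Ventures.CertifiedManyBodySolver.Theorems.WardSlot
open scoped ComplexOrder BigOperators

/-! ##### Site bookkeeping: first-occurrence de-duplication, the sites of a polynomial, the local frame of an EOM word -/

/-- Insert a site unless already present. -/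
def insertSite (x : Site 2) (S : List (Site 2)) : List (Site 2) := if memSite x S then S else x :: S

/-- De-duplicate a site list (keeps one copy of each site). -/
def dedupSites (l : List (Site 2)) : List (Site 2) := l.foldr insertSite []

/-- Membership in `insertSite`. -/
theorem mem_insertSite {x y : Site 2} {S : List (Site 2)} : y ∈ insertSite x S ↔ y = x ∨ y ∈ S := by
  unfold insertSite
  split_ifs with h
  · rw [memSite_iff] at h
    exact ⟨Or.inr, fun h' => h'.elim (fun e => e ▸ h) id⟩
  · exact List.mem_cons

/-- `insertSite` keeps a site list repeat-free. -/
theorem nodupSites_insertSite {x : Site 2} {S : List (Site 2)} (h : nodupSites S = true) : nodupSites (insertSite x S) = true := by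
  unfold insertSite
  split_ifs with hm
  · exact h
  · show (!(memSite x S) && nodupSites S) = true
    rw [Bool.and_eq_true, h]
    cases hx : memSite x S
    · exact ⟨rfl, rfl⟩
    · exact absurd hx hm

/-- `dedupSites l` has the same members as `l`. -/
theorem mem_dedupSites {l : List (Site 2)} {y : Site 2} : y ∈ dedupSites l ↔ y ∈ l := by
  induction l with
  | nil => simp [dedupSites]
  | cons x l ih =>
    rw [dedupSites, List.foldr_cons, ← dedupSites, mem_insertSite, ih, List.mem_cons]

/-- `dedupSites l` is repeat-free. -/
theorem nodupSites_dedupSites : ∀ (l : List (Site 2)), nodupSites (dedupSites l) = true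
  | [] => rfl
  | x :: l => by
    rw [dedupSites, List.foldr_cons, ← dedupSites]
    exact nodupSites_insertSite (nodupSites_dedupSites l)

/-- The (distinct) sites occurring in a word polynomial. -/
def sitesOf (p : QPoly) : List (Site 2) := dedupSites (p.flatMap fun t => wordSites t.2)

/-- Every word of `p` is supported on `sitesOf p`. -/
theorem PSupp_sitesOf (p : QPoly) : PSupp p (sitesOf p).toFinset := by
  intro t ht ℓ hℓ
  rw [List.mem_toFinset, sitesOf, mem_dedupSites, List.mem_flatMap]
  exact ⟨t, ht, List.mem_map.2 ⟨ℓ, hℓ, rfl⟩⟩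

/-- The sites of a polynomial supported in `Λ` lie in `Λ`. -/
theorem sitesOf_subset {p : QPoly} {Λ : Finset (Site 2)} (hp : PSupp p Λ) : (sitesOf p).toFinset ⊆ Λ := by
  intro x hx
  rw [List.mem_toFinset, sitesOf, mem_dedupSites, List.mem_flatMap] at hx
  obtain ⟨t, ht, hx⟩ := hx
  rw [wordSites, List.mem_map] at hx
  obtain ⟨ℓ, hℓ, rfl⟩ := hx
  exact hp t ht ℓ hℓ

/-- The local frame of an EOM word: the king-move neighbourhood of its sites (de-duplicated). -/
def localFrame (B : QPoly) : List (Site 2) := dedupSites (thick (sitesOf B))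

/-- The local frame contains the thickened support. -/
theorem thicken_sitesOf_subset_localFrame (B : QPoly) : thicken (sitesOf B).toFinset 1 ⊆ (localFrame B).toFinset := by
  intro z hz
  rw [thicken, Finset.mem_biUnion] at hz
  obtain ⟨y, hy, hz⟩ := hz
  rw [Nat.floor_one, Finset.mem_image] at hz
  obtain ⟨v, hv, rfl⟩ := hz
  rw [List.mem_toFinset, localFrame, mem_dedupSites]
  exact List.mem_flatMap.2 ⟨y, List.mem_toFinset.1 hy, add_mem_nbhd_of_mem_box hv⟩

/-- The local frame of a word supported in `inner` lies in the frame when `thick inner ⊆ frame`. -/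
theorem localFrame_subset {B : QPoly} {inner frame : List (Site 2)} (hB : PSupp B inner.toFinset)
    (hth : subSites (thick inner) frame = true) : (localFrame B).toFinset ⊆ frame.toFinset := by
  intro z hz
  rw [List.mem_toFinset, localFrame, mem_dedupSites, thick, List.mem_flatMap] at hz
  obtain ⟨y, hy, hz⟩ := hz
  have hy' : y ∈ inner := List.mem_toFinset.1 (sitesOf_subset hB (List.mem_toFinset.2 hy))
  exact List.mem_toFinset.2 ((subSites_iff _ _).1 hth z (List.mem_flatMap.2 ⟨y, hy', hz⟩))

/-! ##### The support-pruned right-hand side -/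

/-- **`rhsPoly` with LOCAL commutators**: Ward rows against `spinPlusPoly (sitesOf X)` / `spinMinusPoly (sitesOf X)`, EOM rows
against `hamPoly (localFrame B)` — same operators (`polyOp_rhsPolyL_eq`), `2·|sites X|` raw terms per Ward row instead of
`2·|frame|`. -/
def rhsPolyL (K : SymCert) : QPoly :=
  (K.gram.flatMap fun g => pscale g.1 (pmul (padj g.2) g.2)) ++ K.gramM.flatMap gramBlockPoly ++
    (K.eom.flatMap fun B => comm (hamPoly (localFrame B)) B) ++
    (K.moves.flatMap fun mv => [(mv.z, moveWord mv.γ mv.v mv.u), (-mv.z, mv.u)]) ++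
    K.charged ++
    (K.wardP.flatMap fun X => comm (spinPlusPoly (sitesOf X)) X) ++
    (K.wardM.flatMap fun X => comm (spinMinusPoly (sitesOf X)) X) ++
    (K.antiH.flatMap fun t => pscale t.1 (psub (padj t.2) t.2)) ++
    K.slack

/-! ##### The commutator rows are operator-invariant under support pruning -/

/-- `[Σ_{x ∈ S} c†_{x↑}c_{x↓}, X] = [S⁺_{Λ″}, X]` as operators, for `X` supported in the repeat-free `S ⊆ Λ″`. -/
theorem polyOp_comm_spinPlusPoly {Λ'' : Finset (Site 2)} (S : List (Site 2)) (hS : nodupSites S = true)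
    (hSL : S.toFinset ⊆ Λ'') (X : QPoly) (hX : PSupp X S.toFinset) :
    polyOp Λ'' (comm (spinPlusPoly S) X) =
      (spinPlus : FermionOp Λ'') * polyOp Λ'' X - polyOp Λ'' X * spinPlus := by
  rw [polyOp_comm, polyOp_incl hSL (spinPlusPoly S) (PSupp_spinPlusPoly S), dict_spinPlus S hS, polyOp_incl hSL X hX,
    ← map_mul, ← map_mul, ← map_sub, ← spinPlus_commutator_transfer hSL]

/-- The same for `S⁻`. -/
theorem polyOp_comm_spinMinusPoly {Λ'' : Finset (Site 2)} (S : List (Site 2)) (hS : nodupSites S = true)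
    (hSL : S.toFinset ⊆ Λ'') (X : QPoly) (hX : PSupp X S.toFinset) :
    polyOp Λ'' (comm (spinMinusPoly S) X) =
      (spinMinus : FermionOp Λ'') * polyOp Λ'' X - polyOp Λ'' X * spinMinus := by
  rw [polyOp_comm, polyOp_incl hSL (spinMinusPoly S) (PSupp_spinMinusPoly S), dict_spinMinus S hS, polyOp_incl hSL X hX,
    ← map_mul, ← map_mul, ← map_sub, ← spinMinus_commutator_transfer hSL]

/-- `[H_S, B] = [H_{Λ″}, B]` as operators, for `B` supported in `I` with `thicken I 1 ⊆ S ⊆ Λ″`, `S` repeat-free. -/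
theorem polyOp_comm_hamPoly {Λ'' : Finset (Site 2)} (S : List (Site 2)) (hS : nodupSites S = true)
    (hSL : S.toFinset ⊆ Λ'') (B : QPoly) (I : Finset (Site 2)) (hB : PSupp B I) (hth : thicken I 1 ⊆ S.toFinset) :
    polyOp Λ'' (comm (hamPoly S) B) =
      (hubbardTTPrimeFermionInteraction 1 0 8).localHamiltonian Λ'' * polyOp Λ'' B -
        polyOp Λ'' B * (hubbardTTPrimeFermionInteraction 1 0 8).localHamiltonian Λ'' := by
  have hIS : I ⊆ S.toFinset := (subset_thicken I 1).trans hth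
  rw [polyOp_comm, polyOp_incl hSL (hamPoly S) (PSupp_hamPoly S), stub_hamDictSound S hS,
    polyOp_incl hSL B (hB.mono hIS), polyOp_incl hIS B hB, ← map_mul, ← map_mul, ← map_sub,
    ← ham_commutator_transfer hIS hth hSL]

/-- **The support-pruned RHS is the same operator as `rhsPoly`** in every window containing the frame. -/
theorem polyOp_rhsPolyL_eq (K : SymCert) (hwf : wellFormed K = true) {Λ'' : Finset (Site 2)}
    (hFL : K.frame.toFinset ⊆ Λ'') : polyOp Λ'' (rhsPolyL K) = polyOp Λ'' (rhsPoly K) := by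
  have hwf' := hwf
  simp only [wellFormed, Bool.and_eq_true] at hwf'
  obtain ⟨⟨⟨⟨⟨⟨⟨⟨⟨⟨⟨⟨⟨hnd, -⟩, -⟩, hIF⟩, hth⟩, -⟩, -⟩, heom⟩, -⟩, -⟩, hwp⟩, hwm⟩, -⟩, -⟩ := hwf'
  have hIF' : K.inner.toFinset ⊆ K.frame.toFinset := fun x hx =>
    List.mem_toFinset.2 ((subSites_iff _ _).1 hIF x (List.mem_toFinset.1 hx))
  have hthF : thicken K.inner.toFinset 1 ⊆ K.frame.toFinset := thicken_subset_of_thick hth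
  have heom' : ∀ B ∈ K.eom, PSupp B K.inner.toFinset := fun B hB => PSupp_of_psuppIn (List.all_eq_true.1 heom B hB)
  have hwp' : ∀ X ∈ K.wardP, PSupp X K.frame.toFinset := fun X hX => PSupp_of_psuppIn (List.all_eq_true.1 hwp X hX)
  have hwm' : ∀ X ∈ K.wardM, PSupp X K.frame.toFinset := fun X hX => PSupp_of_psuppIn (List.all_eq_true.1 hwm X hX)
  have hE : polyOp Λ'' (K.eom.flatMap fun B => comm (hamPoly (localFrame B)) B) =
      polyOp Λ'' (K.eom.flatMap fun B => comm (hamPoly K.frame) B) := by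
    rw [polyOp_flatMap, polyOp_flatMap]
    congr 1
    refine List.map_congr_left fun B hB => ?_
    rw [polyOp_comm_hamPoly (localFrame B) (nodupSites_dedupSites _) ((localFrame_subset (heom' B hB) hth).trans hFL) B
        (sitesOf B).toFinset (PSupp_sitesOf B) (thicken_sitesOf_subset_localFrame B),
      polyOp_comm_hamPoly K.frame hnd hFL B K.inner.toFinset (heom' B hB) hthF]
  have hP : polyOp Λ'' (K.wardP.flatMap fun X => comm (spinPlusPoly (sitesOf X)) X) =
      polyOp Λ'' (K.wardP.flatMap fun X => comm (spinPlusPoly K.frame) X) := by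
    rw [polyOp_flatMap, polyOp_flatMap]
    congr 1
    refine List.map_congr_left fun X hX => ?_
    rw [polyOp_comm_spinPlusPoly (sitesOf X) (nodupSites_dedupSites _) ((sitesOf_subset (hwp' X hX)).trans hFL) X
        (PSupp_sitesOf X), polyOp_comm_spinPlusPoly K.frame hnd hFL X (hwp' X hX)]
  have hM : polyOp Λ'' (K.wardM.flatMap fun X => comm (spinMinusPoly (sitesOf X)) X) =
      polyOp Λ'' (K.wardM.flatMap fun X => comm (spinMinusPoly K.frame) X) := by
    rw [polyOp_flatMap, polyOp_flatMap]
    congr 1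
    refine List.map_congr_left fun X hX => ?_
    rw [polyOp_comm_spinMinusPoly (sitesOf X) (nodupSites_dedupSites _) ((sitesOf_subset (hwm' X hX)).trans hFL) X
        (PSupp_sitesOf X), polyOp_comm_spinMinusPoly K.frame hnd hFL X (hwm' X hX)]
  simp only [rhsPolyL, rhsPoly, polyOp_append, hE, hP, hM]

/-- The support-pruned RHS is supported in the frame (from the `wellFormed` clauses). -/
theorem PSupp_rhsPolyL (K : SymCert) (hwf : wellFormed K = true) : PSupp (rhsPolyL K) K.frame.toFinset := by
  have hwf' := hwf
  simp only [wellFormed, Bool.and_eq_true] at hwf'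
  obtain ⟨⟨⟨⟨⟨⟨⟨⟨⟨⟨⟨⟨⟨-, -⟩, -⟩, hIF⟩, hth⟩, hgram⟩, hgM⟩, heom⟩, hmov⟩, hch⟩, hwp⟩, hwm⟩, hah⟩, hsl⟩ := hwf'
  have hIF' : K.inner.toFinset ⊆ K.frame.toFinset := fun x hx =>
    List.mem_toFinset.2 ((subSites_iff _ _).1 hIF x (List.mem_toFinset.1 hx))
  have hg : ∀ g ∈ K.gram, PSupp g.2 K.frame.toFinset := fun g hg => by
    have h := List.all_eq_true.1 hgram g hg
    rw [Bool.and_eq_true] at h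
    exact PSupp_of_psuppIn h.2
  have hgM' : ∀ B ∈ K.gramM, ∀ q ∈ B.basis, PSupp q K.frame.toFinset := fun B hB q hq => by
    have h := List.all_eq_true.1 hgM B hB
    simp only [gramBlockOK, Bool.and_eq_true, List.all_eq_true] at h
    exact PSupp_of_psuppIn (h.2 q hq)
  have heom' : ∀ B ∈ K.eom, PSupp B K.inner.toFinset := fun B hB => PSupp_of_psuppIn (List.all_eq_true.1 heom B hB)
  have hmov' : ∀ mv ∈ K.moves, suppIn mv.u K.frame = true ∧ suppIn (moveWordF mv.γ mv.v mv.u) K.frame = true :=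
    fun mv hmv => by
      have h := List.all_eq_true.1 hmov mv hmv
      rwa [Bool.and_eq_true] at h
  have hch' : ∀ t ∈ K.charged, SuppIn t.2 K.frame.toFinset := fun t ht => by
    have h := List.all_eq_true.1 hch t ht
    rw [Bool.and_eq_true] at h
    exact SuppIn_of_suppIn h.1
  have hwp' : ∀ X ∈ K.wardP, PSupp X K.frame.toFinset := fun X hX => PSupp_of_psuppIn (List.all_eq_true.1 hwp X hX)
  have hwm' : ∀ X ∈ K.wardM, PSupp X K.frame.toFinset := fun X hX => PSupp_of_psuppIn (List.all_eq_true.1 hwm X hX)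
  have hah' : ∀ t ∈ K.antiH, PSupp t.2 K.frame.toFinset := fun t ht => PSupp_of_psuppIn (List.all_eq_true.1 hah t ht)
  have hsl' : ∀ t ∈ K.slack, SuppIn t.2 K.frame.toFinset := fun t ht => SuppIn_of_suppIn (List.all_eq_true.1 hsl t ht)
  refine PSupp.append ?_ hsl'
  refine PSupp.append ?_ (PSupp.flatMap _ _ fun t ht => ((hah' t ht).padj.psub (hah' t ht)).pscale _)
  refine PSupp.append ?_ (PSupp.flatMap _ _ fun X hX =>
    ((PSupp_spinMinusPoly (sitesOf X)).mono (sitesOf_subset (hwm' X hX))).comm (hwm' X hX))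
  refine PSupp.append ?_ (PSupp.flatMap _ _ fun X hX =>
    ((PSupp_spinPlusPoly (sitesOf X)).mono (sitesOf_subset (hwp' X hX))).comm (hwp' X hX))
  refine PSupp.append ?_ hch'
  refine PSupp.append ?_ (PSupp.flatMap _ _ fun mv hmv => ?_)
  · refine PSupp.append ?_ (PSupp.flatMap _ _ fun B hB =>
      ((PSupp_hamPoly (localFrame B)).mono (localFrame_subset (heom' B hB) hth)).comm ((heom' B hB).mono hIF'))
    refine PSupp.append ?_ (PSupp.flatMap _ _ fun B hB => PSupp_gramBlockPoly B (hgM' B hB))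
    exact PSupp.flatMap _ _ fun g hg' => ((hg g hg').padj.pmul (hg g hg')).pscale _
  · intro t ht
    simp only [List.mem_cons, List.not_mem_nil, or_false] at ht
    rcases ht with rfl | rfl
    · rw [← moveWordF_eq]; exact SuppIn_of_suppIn (hmov' mv hmv).2
    · exact SuppIn_of_suppIn (hmov' mv hmv).1

/-- Kernel regression: the toy certificates have no Ward/EOM rows, so `rhsPolyL = rhsPoly` there; on a one-row example
the local Ward commutator has 2 sites' worth of terms. -/
example : (comm (spinPlusPoly (sitesOf [((1 : ℚ), [cre 0 0, ann e1 0])])) [((1 : ℚ), [cre 0 0, ann e1 0])]).length = 4 := by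
  decide +kernel

end Summit.Ventures.CertifiedManyBodySolver.Theorems.SymReplay

end
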